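import Mathlib.Analysis.SpecialFunctions.Exp
import Literature.Barriers.QuantumAdvantage.LinearXEBSpoofing
import Literature.Computability.QuantumComplexity.PureStateSamplingBound
import HarnessLib

/-!
# Linear XEB of composite systems: product distributions, marginal samplers, patch estimates

Topic `Literature/Computability/QuantumComplexity` (pub-qadeq lane, CLAIMS rows E-01…E-10 — the
random-circuit-sampling experiments scored by the linear cross-entropy benchmark — and §5.1 item
S-7, the calibrated *partial* spoofs of those instances).

HONEST FRAMING: instance-level adjudication of specific advantage claims; no claim about BQP vs BPP
or the summit. This file proves three elementary, published identities about the population linear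
XEB `F_q(p) = N Σₓ q(x) p(x) − 1` (the tree's `Literature.Barriers.QuantumAdvantage.linearXEB`) of
COMPOSITE systems; nothing here is a statement about any particular circuit family, and the
Porter–Thomas reading `F_q(q) ≈ 1` of the primaries is never assumed (where a printed sentence uses
it, the theorem below carries the per-subsystem value `F_{qᵢ}(pᵢ)` as a free parameter instead).

## Contents (all proved, 0 named facts)

* §1 `piPMF p` (`x ↦ Πᵢ pᵢ(xᵢ)` on `Π i, α i`) and `prodPMF p₁ p₂` (on `α × β`); Gao et al.'s
  composite-system rule **`F + 1` is multiplicative**: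
  `linearXEB_piPMF_add_one` (`F_{⊗qᵢ}(⊗pᵢ) + 1 = Πᵢ (F_{qᵢ}(pᵢ) + 1)`), the binary form
  `linearXEB_prodPMF_add_one`, and the printed "`≈ Σᵢ χᵢ`" made two-sided:
  `sum_linearXEB_le_linearXEB_piPMF` (`Σᵢ χᵢ ≤ χ_total` when every `χᵢ ≥ 0`) and
  `linearXEB_piPMF_add_one_le_exp_sum` (`χ_total + 1 ≤ exp (Σᵢ χᵢ)` when every `χᵢ ≥ −1`)
  [cite: GaoEtAl2024, §I A ("Scaling of XEB and fidelity"), eqs. (2)–(3)].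
* §2 **fidelity is multiplicative**: `piVec u` (`x ↦ Πᵢ uᵢ(xᵢ)`), `sum_norm_sq_piVec`
  (a product of unit vectors is a unit vector) and `overlapSq_piVec`
  (`|⟨⊗uᵢ|⊗vᵢ⟩|² = Πᵢ |⟨uᵢ|vᵢ⟩|²`, the tree's `overlapSq`) — "the fidelity scales multiplicatively,
  i.e. `F_total = Πᵢ Fᵢ`, while the XEB additively" [cite: GaoEtAl2024, §I A eqs. (2)–(3)].
* §3 Barak–Chou–Gao's **marginal sampler**: on the outcome space `ι → σ` (`n = |ι|` sites, local
  alphabet `σ`, `|σ| = 2` for qubits) and a set of sites `I`, `marginalOn I q` is the marginal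
  `q(I, x_I) = Σ_{y : y_I = x_I} q(y)` and `marginalSampler I p_I` the distribution
  `x ↦ p_I(x_I) / |σ|^{n − |I|}` ("sample `x_I` …; for any `i ∉ I` sample `xᵢ` uniformly");
  `linearXEB_marginalSampler` (`F_q = F_{q(I,·)}(p_I)`: the benchmark only sees the marginal on
  `I`), the printed `linearXEB_marginalSampler_marginalOn`
  (`F_C(A_C) = 2^m Σ_{x_I} q_C(I,x_I)² − 1`, the first display of §5), its cap
  `linearXEB_marginalSampler_marginalOn_le` (`≤ 2^m − 1`, the step "by [§5's first display],
  `F_C(A_C) ≤ 2^m`" of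
  the proof of the §5.1 corollary ‘Lower bounding the probability of success’) and the
  disjoint-light-cone product form
  `linearXEB_marginalSampler_of_prod` (`= Π_j (2 Σ_b q_C({i_j}, b)²) − 1`)
  [cite: BarakChouGao2021, §3 Algorithm 1, §5 (first display), §5.1, App. §7 Lemma ‘Disjoint light
  cone’]; plus the Bernoulli
  step `mul_le_one_add_pow_sub_one` behind "`(1 + 15^{−d})^m − 1 = Ω(m · 15^{−d})`"
  [cite: BarakChouGao2021, Thm 1 and abstract].
* §4 Google's **patch-circuit estimate**: `fstMarginal`/`sndMarginal`, `patchXEB q₁ q₂ P`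
  (= product of the two per-patch linear XEBs computed from the marginals of the joint samples —
  "the two patches are analyzed separately when computing the fidelity … F_XEB of the full system
  can
  be estimated as the product of the fidelities of the two subsystems")
  [cite: AruteEtAl2019, Supplementary Information §VIII B]; under independent global depolarizing
  noise on the two patches (`depolarize Fᵢ pᵢ`, tree) `patchXEB_prodPMF_depolarize`
  (`= (F₁ F_{q₁}(p₁)) · (F₂ F_{q₂}(p₂))`) versus the whole-system benchmark against the product
  ideal
  `linearXEB_prodPMF_depolarize_add_one` (`F + 1 = (F₁ F_{q₁}(p₁) + 1)(F₂ F_{q₂}(p₂) + 1)`) — the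
  two
  numbers Gao et al. contrast.

## References

* [GaoEtAl2024] X. Gao, M. Kalinowski, C.-N. Chou, M. D. Lukin, B. Barak, S. Choi, *Limitations of
  linear cross-entropy as a measure for quantum advantage*, PRX Quantum 5, 010334 (2024) =
  arXiv:2112.01657, §I A, paragraph "Scaling of XEB and fidelity": "Let us consider `k` disjoint
  `N`-qubit systems … XEB values `χᵢ = 2^N Σₓ pᵢ(x) qᵢ(x) − 1` and fidelities `Fᵢ` … one can
  explicitly check that the fidelity scales multiplicatively, i.e. `F_total = Πᵢ Fᵢ`, while the XEB
  additively: `χ_total = 2^{kN} Σ_{{xᵢ}} Πᵢ pᵢ(xᵢ) qᵢ(xᵢ) − 1 = Πᵢ (χᵢ + 1) − 1 ≈ Σᵢ χᵢ`, where we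
  assumed that `χᵢ ≪ 1` in the last line" (read via `lit read arxiv:2112.01657`, tex chunk p0006;
  the
  two displayed lines are eqs. (2)–(3), eq. (1) being the definition of the XEB).
* [BarakChouGao2021] B. Barak, C.-N. Chou, X. Gao, *Spoofing linear cross-entropy benchmarking in
  shallow quantum circuits*, ITCS 2021, LIPIcs 185, 30 = arXiv:2005.02421, §3 Algorithm 1 ("Sample
  `x_{i₁}, …, x_{i_m}` according to the marginal probabilities … For any `i ∉ {i₁,…,i_m}`, sample
  `xᵢ`
  uniformly random from `{0,1}`"), §5 ("`A_C(x) = q_C(I,x_I)/2^{n−m}` … `F_C(A_C) = 2^n Σₓ q_C(x)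
  q_C(I,x_I)/2^{n−m} − 1 = 2^m Σ_{x_I} q_C(I,x_I)² − 1` … by [Lemma ‘Disjoint light cone’],
  `q_C(I,x_I) = Π_j
  q_C({i_j}, x_{i_j})`. Thus `= Σ_{x_I} Π_j 2 q_C({x_{i_j}}, x_{i_j})² − 1`"; §5.1, proof of the
  corollary ‘Lower bounding the probability of success’:
  "since our algorithm picks `n − m` bits uniformly at random, for every circuit `C`, by [§5's
  first display],
  `F_C(A_C) ≤ 2^m`") (read via `lit read arxiv:2005.02421`, tex chunks p0008, p0012).
* [AruteEtAl2019] F. Arute et al., *Quantum supremacy using a programmable superconducting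
  processor*, Nature 574, 505 (2019), Supplementary Information §VIII B "Patch circuits: a quick
  performance indicator for large systems": "predicts the performance of the full system by
  multiplying together the fidelities of non-interacting subsystems, or “patches” … the two patches
  are analyzed separately when computing the fidelity … F_XEB of the full system can be estimated as
  the product of the fidelities of the two subsystems" (arXiv:1910.11333, tex chunk p0023).
* [NielsenChuang2010] M. A. Nielsen, I. L. Chuang, *Quantum Computation and Quantum Information*,
  10th anniversary ed., CUP 2010, §2.1.7 eq. (2.49) (inner product on `V ⊗ W`), p. 73.
* [BoulandFeffermanLandauLiu2022] A. Bouland, B. Fefferman, Z. Landau, Y. Liu, *Noise and the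
  frontier of quantum supremacy*, FOCS 2021, §1 (global depolarizing model; the tree's
  `depolarize`).

## Design notes

* As in `LinearXEBSpoofing.lean`, distributions are real mass functions with explicit hypotheses
  where needed; most identities below are pure algebra and hold for arbitrary real `q`, `p`.
* The equation numbers (2)–(3) are those of the arXiv version read; BCG's displays, lemmas and the
  §5.1 corollary are cited by NAME (‘Disjoint light cone’, ‘Lower bounding the probability of
  success’) because theorem counters differ between renderings; the journal versions carry the same
  statements.
-/

noncomputable section

open Finset
open scoped ComplexConjugate

namespace Literature.Computability.QuantumComplexity.XEB

open Literature.Barriers.QuantumAdvantage (linearXEB depolarize linearXEB_depolarize)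

/-! ### §1 Product distributions: `F + 1` is multiplicative (Gao et al. eqs. (2)–(3)) -/

section Pi

variable {ι : Type*} [Fintype ι] {α : ι → Type*}

/-- The product mass function `x ↦ Πᵢ pᵢ(xᵢ)` of a family of mass functions `pᵢ` on the factors of
`Π i, α i` (`k` disjoint subsystems viewed as one composite system). [folklore] -/
def piPMF (p : ∀ i, α i → ℝ) : (∀ i, α i) → ℝ := fun x => ∏ i, p i (x i)

/-- A product of nonnegative mass functions is nonnegative (plumbing for the composite system of
eqs. (2)–(3)). [cite: GaoEtAl2024, §I A eqs. (2)–(3)] -/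
theorem piPMF_nonneg {p : ∀ i, α i → ℝ} (hp : ∀ i a, 0 ≤ p i a) (x : ∀ i, α i) :
    0 ≤ piPMF p x :=
  Finset.prod_nonneg fun i _ => hp i (x i)

/-- Pointwise, `(⊗qᵢ)(x) · (⊗pᵢ)(x) = ⊗(qᵢ pᵢ)(x)` — the integrand `Πᵢ pᵢ(xᵢ) qᵢ(xᵢ)` of eq. (2).
[cite: GaoEtAl2024, §I A eqs. (2)–(3)] -/
theorem piPMF_mul_piPMF (q p : ∀ i, α i → ℝ) (x : ∀ i, α i) :
    piPMF q x * piPMF p x = piPMF (fun i a => q i a * p i a) x := by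
  unfold piPMF
  rw [← Finset.prod_mul_distrib]

variable [DecidableEq ι] [∀ i, Fintype (α i)]

/-- `Σₓ Πᵢ fᵢ(xᵢ) = Πᵢ Σ_a fᵢ(a)` (finite Fubini) — the "one can explicitly check" step from eq. (2)
to eq. (3). [cite: GaoEtAl2024, §I A eqs. (2)–(3)] -/
theorem sum_piPMF (p : ∀ i, α i → ℝ) : ∑ x, piPMF p x = ∏ i, ∑ a, p i a := by
  unfold piPMF
  rw [Finset.prod_univ_sum, Fintype.piFinset_univ]

/-- A product of distributions is a distribution (the composite `kN`-qubit system of eq. (2)).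
[cite: GaoEtAl2024, §I A eqs. (2)–(3)] -/
theorem sum_piPMF_eq_one {p : ∀ i, α i → ℝ} (hp : ∀ i, ∑ a, p i a = 1) : ∑ x, piPMF p x = 1 := by
  rw [sum_piPMF]
  exact Finset.prod_eq_one fun i _ => hp i

/-- **Gao et al., eqs. (2)–(3): for `k` disjoint subsystems "the XEB [scales] additively":
`χ_total = 2^{kN} Σ_{{xᵢ}} Πᵢ pᵢ(xᵢ) qᵢ(xᵢ) − 1 = Πᵢ (χᵢ + 1) − 1`.** Here with arbitrary finite
factors `α i` in place of `N` qubits each: `F_{⊗qᵢ}(⊗pᵢ) + 1 = Πᵢ (F_{qᵢ}(pᵢ) + 1)`.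
[cite: GaoEtAl2024, §I A ("Scaling of XEB and fidelity") eqs. (2)–(3)] -/
theorem linearXEB_piPMF_add_one (q p : ∀ i, α i → ℝ) :
    linearXEB (piPMF q) (piPMF p) + 1 = ∏ i, (linearXEB (q i) (p i) + 1) := by
  simp only [linearXEB, sub_add_cancel]
  rw [Fintype.card_pi, Nat.cast_prod, Finset.prod_mul_distrib]
  congr 1
  simp_rw [piPMF_mul_piPMF]
  exact sum_piPMF _

/-- The printed "`Πᵢ (χᵢ + 1) − 1 ≈ Σᵢ χᵢ`, where we assumed that `χᵢ ≪ 1`" made one-sided and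
exact: when every subsystem value is nonnegative, `Σᵢ F_{qᵢ}(pᵢ) ≤ F_{⊗qᵢ}(⊗pᵢ)` (Weierstrass'
product inequality) — "when multiple
systems are brought together to form a larger one, the XEB generally increases with the number of
subsystems". [cite: GaoEtAl2024, §I A eqs. (2)–(3)] -/
theorem sum_linearXEB_le_linearXEB_piPMF (q p : ∀ i, α i → ℝ)
    (h : ∀ i, 0 ≤ linearXEB (q i) (p i)) :
    ∑ i, linearXEB (q i) (p i) ≤ linearXEB (piPMF q) (piPMF p) := by
  have key : ∀ s : Finset ι,
      ∑ i ∈ s, linearXEB (q i) (p i) + 1 ≤ ∏ i ∈ s, (linearXEB (q i) (p i) + 1) := by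
    intro s
    induction s using Finset.induction_on with
    | empty => simp
    | insert a s ha ih =>
      rw [Finset.sum_insert ha, Finset.prod_insert ha]
      have h1 : 0 ≤ linearXEB (q a) (p a) := h a
      have h2 : 0 ≤ ∑ i ∈ s, linearXEB (q i) (p i) := Finset.sum_nonneg fun i _ => h i
      have h3 : 1 ≤ ∏ i ∈ s, (linearXEB (q i) (p i) + 1) :=
        Finset.one_le_prod fun i _ => by linarith [h i]
      nlinarith
  have := key Finset.univ
  linarith [linearXEB_piPMF_add_one q p]

/-- … and from above: when every `F_{qᵢ}(pᵢ) ≥ −1` (automatic for nonnegative `qᵢ`, `pᵢ`),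
`F_{⊗qᵢ}(⊗pᵢ) + 1 ≤ exp (Σᵢ F_{qᵢ}(pᵢ))` (`1 + x ≤ eˣ` factorwise), so that `χ_total ≈ Σᵢ χᵢ` to
first order. [cite: GaoEtAl2024, §I A eqs. (2)–(3)] -/
theorem linearXEB_piPMF_add_one_le_exp_sum (q p : ∀ i, α i → ℝ)
    (h : ∀ i, -1 ≤ linearXEB (q i) (p i)) :
    linearXEB (piPMF q) (piPMF p) + 1 ≤ Real.exp (∑ i, linearXEB (q i) (p i)) := by
  rw [linearXEB_piPMF_add_one, Real.exp_sum]
  exact Finset.prod_le_prod (fun i _ => by linarith [h i])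
    fun i _ => by linarith [Real.add_one_le_exp (linearXEB (q i) (p i))]

/-- Nonnegative `q`, `p` give `F_q(p) ≥ −1` (immediate from the definition
`F_C(p) = 2ⁿ E_{x∼p} q_C(x) − 1`). [cite: BarakChouGao2021, §1] -/
theorem neg_one_le_linearXEB {β : Type*} [Fintype β] {q p : β → ℝ} (hq : ∀ x, 0 ≤ q x)
    (hp : ∀ x, 0 ≤ p x) : -1 ≤ linearXEB q p := by
  unfold linearXEB
  have : 0 ≤ (Fintype.card β : ℝ) * ∑ x, q x * p x :=
    mul_nonneg (Nat.cast_nonneg _) (Finset.sum_nonneg fun x _ => mul_nonneg (hq x) (hp x))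
  linarith

end Pi

section Prod

variable {α β : Type*}

/-- The product mass function `(a, b) ↦ p₁(a) p₂(b)` of two subsystems. [folklore] -/
def prodPMF (p₁ : α → ℝ) (p₂ : β → ℝ) : α × β → ℝ := fun x => p₁ x.1 * p₂ x.2

variable [Fintype α] [Fintype β]

/-- `Σ_{(a,b)} p₁(a) p₂(b) = (Σ p₁)(Σ p₂)` (the `k = 2` Fubini step of eqs. (2)–(3)).
[cite: GaoEtAl2024, §I A eqs. (2)–(3)] -/
theorem sum_prodPMF (p₁ : α → ℝ) (p₂ : β → ℝ) :
    ∑ x, prodPMF p₁ p₂ x = (∑ a, p₁ a) * ∑ b, p₂ b := by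
  unfold prodPMF
  rw [Fintype.sum_prod_type, Finset.sum_mul_sum]

/-- **Two subsystems: `F_{q₁⊗q₂}(p₁⊗p₂) + 1 = (F_{q₁}(p₁) + 1)(F_{q₂}(p₂) + 1)`** (the case `k = 2`
of Gao et al.'s eqs. (2)–(3)). [cite: GaoEtAl2024, §I A eqs. (2)–(3)] -/
theorem linearXEB_prodPMF_add_one (q₁ p₁ : α → ℝ) (q₂ p₂ : β → ℝ) :
    linearXEB (prodPMF q₁ q₂) (prodPMF p₁ p₂) + 1 =
      (linearXEB q₁ p₁ + 1) * (linearXEB q₂ p₂ + 1) := by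
  simp only [linearXEB, sub_add_cancel]
  have hmul : ∀ x : α × β, prodPMF q₁ q₂ x * prodPMF p₁ p₂ x =
      prodPMF (fun a => q₁ a * p₁ a) (fun b => q₂ b * p₂ b) x := by
    intro x; simp only [prodPMF]; ring
  simp_rw [hmul, sum_prodPMF]
  rw [Fintype.card_prod, Nat.cast_mul]
  ring

end Prod

/-! ### §2 Fidelity is multiplicative (Gao et al.: "`F_total = Πᵢ Fᵢ`") -/

section Fidelity

variable {ι : Type*} [Fintype ι] {α : ι → Type*}

/-- The product amplitude vector `x ↦ Πᵢ uᵢ(xᵢ)` (the state `⊗ᵢ uᵢ` in the computational basis of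
the composite system). [folklore] -/
def piVec (u : ∀ i, α i → ℂ) : (∀ i, α i) → ℂ := fun x => ∏ i, u i (x i)

variable [DecidableEq ι] [∀ i, Fintype (α i)]

/-- `Σₓ ‖(⊗uᵢ)(x)‖² = Πᵢ Σ_a ‖uᵢ(a)‖²` (norm of a tensor product of vectors).
[cite: NielsenChuang2010, §2.1.7 eq. (2.49) (the inner product on `V ⊗ W`)] -/
theorem sum_norm_sq_piVec (u : ∀ i, α i → ℂ) :
    ∑ x, ‖piVec u x‖ ^ 2 = ∏ i, ∑ a, ‖u i a‖ ^ 2 := by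
  have : ∀ x : ∀ i, α i, ‖piVec u x‖ ^ 2 = ∏ i, ‖u i (x i)‖ ^ 2 := by
    intro x
    rw [piVec, norm_prod, Finset.prod_pow]
  simp_rw [this]
  rw [Finset.prod_univ_sum, Fintype.piFinset_univ]

/-- In particular a tensor product of unit vectors is a unit vector.
[cite: NielsenChuang2010, §2.1.7 eq. (2.49)] -/
theorem sum_norm_sq_piVec_eq_one {u : ∀ i, α i → ℂ} (hu : ∀ i, ∑ a, ‖u i a‖ ^ 2 = 1) :
    ∑ x, ‖piVec u x‖ ^ 2 = 1 := by
  rw [sum_norm_sq_piVec]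
  exact Finset.prod_eq_one fun i _ => hu i

/-- **"the fidelity scales multiplicatively, i.e. `F_total = Πᵢ Fᵢ`"**: for product pure states,
`|⟨⊗uᵢ | ⊗vᵢ⟩|² = Πᵢ |⟨uᵢ|vᵢ⟩|²` (the tree's `overlapSq`; the inner product of product vectors is
the
product of the inner products). [cite: GaoEtAl2024, §I A eqs. (2)–(3)]
[cite: NielsenChuang2010, §2.1.7 eq. (2.49)] -/
theorem overlapSq_piVec (u v : ∀ i, α i → ℂ) :
    overlapSq (piVec u) (piVec v) = ∏ i, overlapSq (u i) (v i) := by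
  unfold overlapSq
  have hx : ∀ x : ∀ i, α i, conj (piVec u x) * piVec v x = ∏ i, (conj (u i (x i)) * v i (x i)) := by
    intro x
    rw [piVec, piVec, map_prod, ← Finset.prod_mul_distrib]
  simp_rw [hx]
  rw [← Fintype.piFinset_univ, ← Finset.prod_univ_sum (fun _ => Finset.univ)
    (fun i a => conj (u i a) * v i a), norm_prod, Finset.prod_pow]

end Fidelity

/-! ### §3 Barak–Chou–Gao's marginal sampler (§3 Algorithm 1; §5 (first display); §5.1; Lemma
‘Disjoint light cone’) -/

section Marginal

variable {ι σ : Type*} [Fintype ι] [Fintype σ]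

/-- **Barak–Chou–Gao's sampler** (Algorithm 1, steps 3–4, with an arbitrary distribution `p_I` on
the
chosen sites in place of the computed marginals): output `x` with probability
`p_I(x_I) / |σ|^{n − |I|}` — "`x_I` according to [`p_I`] … for any `i ∉ I`, sample `xᵢ` uniformly
random". For `p_I = q_C(I,·)` this is their `A_C(x) = q_C(I,x_I)/2^{n−m}`.
[cite: BarakChouGao2021, §3 Algorithm 1 and §5] -/
def marginalSampler (I : Finset ι) (pI : (I → σ) → ℝ) : (ι → σ) → ℝ :=
  fun x => pI (I.restrict x) / (Fintype.card σ : ℝ) ^ (Fintype.card ι - I.card)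

/-- The sampler's weights are nonnegative when `p_I` is. [cite: BarakChouGao2021, §3 Algorithm 1] -/
theorem marginalSampler_nonneg (I : Finset ι) {pI : (I → σ) → ℝ} (hp : ∀ xI, 0 ≤ pI xI)
    (x : ι → σ) : 0 ≤ marginalSampler I pI x :=
  div_nonneg (hp _) (pow_nonneg (Nat.cast_nonneg _) _)

variable [DecidableEq ι]

omit [Fintype ι] in
/-- `|I → σ| = |σ|^{|I|}` (the `2^m` of §5's first display).
[cite: BarakChouGao2021, §5 (first display)] -/
theorem card_restrict_fun (I : Finset ι) :
    (Fintype.card (I → σ) : ℝ) = (Fintype.card σ : ℝ) ^ I.card := by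
  rw [Fintype.card_fun, Fintype.card_coe, Nat.cast_pow]

/-- `|ι → σ| = |σ|^{|I|} · |σ|^{n − |I|}` (the counting step `2ⁿ / 2^{n−m} = 2^m` of §5's first
display).
[cite: BarakChouGao2021, §5 (first display)] -/
theorem card_fun_eq_pow_mul_pow (I : Finset ι) :
    (Fintype.card (ι → σ) : ℝ) =
      (Fintype.card σ : ℝ) ^ I.card * (Fintype.card σ : ℝ) ^ (Fintype.card ι - I.card) := by
  rw [Fintype.card_fun, Nat.cast_pow, ← pow_add, Nat.add_sub_cancel' (Finset.card_le_univ I)]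

variable [DecidableEq σ]

/-- The **marginal on the sites `I`** of a mass function `q` on `ι → σ`:
`q(I, x_I) = Σ_{y : y_I = x_I} q(y)` ("let `q(I,x_I)` denote the marginal probability of the output
qubit[s] at location `I` being `x_I`"). [cite: BarakChouGao2021, §5 (notation)] -/
def marginalOn (I : Finset ι) (q : (ι → σ) → ℝ) (xI : I → σ) : ℝ :=
  ∑ y ∈ Finset.univ.filter (fun y : ι → σ => I.restrict y = xI), q y

/-- Marginals of a nonnegative `q` are nonnegative. [cite: BarakChouGao2021, §5 (notation)] -/
theorem marginalOn_nonneg (I : Finset ι) {q : (ι → σ) → ℝ} (hq : ∀ y, 0 ≤ q y) (xI : I → σ) :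
    0 ≤ marginalOn I q xI :=
  Finset.sum_nonneg fun y _ => hq y

/-- Fibrewise summation: `Σ_y q(y) f(y_I) = Σ_{x_I} q(I,x_I) f(x_I)` — the step
`2ⁿ Σₓ q_C(x) q_C(I,x_I)/2^{n−m} = 2^m Σ_{x_I} q_C(I,x_I)²` of §5's first display, for a general
weight `f`.
[cite: BarakChouGao2021, §5 (first display)] -/
theorem sum_mul_apply_restrict (I : Finset ι) (q : (ι → σ) → ℝ) (f : (I → σ) → ℝ) :
    ∑ y, q y * f (I.restrict y) = ∑ xI, marginalOn I q xI * f xI := by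
  unfold marginalOn
  simp_rw [Finset.sum_mul]
  rw [← Finset.sum_fiberwise Finset.univ (fun y : ι → σ => I.restrict y)
    (fun y => q y * f (I.restrict y))]
  refine Finset.sum_congr rfl fun xI _ => Finset.sum_congr rfl fun y hy => ?_
  rw [(Finset.mem_filter.mp hy).2]

/-- The marginals sum to the total mass: `Σ_{x_I} q(I,x_I) = Σ_y q(y)` (so `q_C(I,·)` is a
distribution on `{0,1}^I`). [cite: BarakChouGao2021, §5 (notation) and §3 Algorithm 1 step 3] -/
theorem sum_marginalOn (I : Finset ι) (q : (ι → σ) → ℝ) :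
    ∑ xI, marginalOn I q xI = ∑ y, q y := by
  have h := sum_mul_apply_restrict I q (fun _ => 1)
  simpa using h.symm

/-- The number of full strings extending a given `x_I` is `|σ|^{n − |I|}` (they correspond to the
functions on the complement of `I`; the normalisation `1/2^{n−m}` of `A_C`).
[cite: BarakChouGao2021, §5 (first display)] -/
theorem card_filter_restrict_eq (I : Finset ι) (xI : I → σ) :
    ((Finset.univ.filter fun y : ι → σ => I.restrict y = xI).card : ℝ) =
      (Fintype.card σ : ℝ) ^ (Fintype.card ι - I.card) := by
  have hbij : (Finset.univ.filter fun y : ι → σ => I.restrict y = xI).card =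
      Fintype.card ({i // i ∉ I} → σ) := by
    rw [← Fintype.card_coe]
    refine Fintype.card_congr ?_
    exact
      { toFun := fun y => fun i => (y.1 : ι → σ) i.1
        invFun := fun z => ⟨fun i => if h : i ∈ I then xI ⟨i, h⟩ else z ⟨i, h⟩,
          Finset.mem_filter.mpr ⟨Finset.mem_univ _, funext fun i => by
            simp only [Finset.restrict, dif_pos i.2]⟩⟩
        left_inv := by
          rintro ⟨y, hy⟩
          have hy' : I.restrict y = xI := (Finset.mem_filter.mp hy).2
          apply Subtype.ext
          funext i
          by_cases h : i ∈ I
          · simp only [dif_pos h]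
            rw [← hy']
            rfl
          · simp only [dif_neg h]
        right_inv := by
          intro z
          funext i
          simp only [dif_neg i.2] }
  rw [hbij, Fintype.card_fun, Fintype.card_subtype_compl, Fintype.card_coe, Nat.cast_pow]

/-- The sampler's total mass is that of `p_I` (so `A_C` is a distribution when `p_I` is).
[cite: BarakChouGao2021, §3 Algorithm 1 and §5] -/
theorem sum_marginalSampler (I : Finset ι) (pI : (I → σ) → ℝ) (hσ : 0 < Fintype.card σ) :
    ∑ x, marginalSampler I pI x = ∑ xI, pI xI := by
  have hpos : (0 : ℝ) < (Fintype.card σ : ℝ) ^ (Fintype.card ι - I.card) :=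
    pow_pos (by exact_mod_cast hσ) _
  unfold marginalSampler
  simp_rw [div_eq_mul_inv]
  rw [← Finset.sum_mul]
  have h := sum_mul_apply_restrict I (fun _ : ι → σ => (1 : ℝ)) pI
  simp only [one_mul] at h
  rw [h]
  have hm : ∀ xI : I → σ, marginalOn I (fun _ : ι → σ => (1 : ℝ)) xI =
      (Fintype.card σ : ℝ) ^ (Fintype.card ι - I.card) := by
    intro xI
    simp only [marginalOn, Finset.sum_const, nsmul_eq_mul, mul_one]
    exact card_filter_restrict_eq I xI
  simp_rw [hm]
  rw [← Finset.mul_sum, mul_comm, ← mul_assoc, inv_mul_cancel₀ hpos.ne', one_mul]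

/-- **The benchmark only sees the marginal on `I`**: for every reference `q` on `ι → σ` and every
`p_I`, `F_q(marginalSampler I p_I) = F_{q(I,·)}(p_I) = |σ|^{|I|} Σ_{x_I} q(I,x_I) p_I(x_I) − 1`
(the first line of §5's first display, with `q_C(I,·)` replaced by a general `p_I`).
[cite: BarakChouGao2021, §5 (first display)] -/
theorem linearXEB_marginalSampler (I : Finset ι) (q : (ι → σ) → ℝ) (pI : (I → σ) → ℝ)
    (hσ : 0 < Fintype.card σ) :
    linearXEB q (marginalSampler I pI) = linearXEB (marginalOn I q) pI := by
  have hpos : (0 : ℝ) < (Fintype.card σ : ℝ) ^ (Fintype.card ι - I.card) :=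
    pow_pos (by exact_mod_cast hσ) _
  unfold linearXEB
  rw [card_fun_eq_pow_mul_pow I, card_restrict_fun I]
  congr 1
  unfold marginalSampler
  simp_rw [div_eq_mul_inv, ← mul_assoc]
  rw [← Finset.sum_mul, sum_mul_apply_restrict I q pI]
  field_simp

/-- **§5's first display as printed**: with `p_I = q_C(I,·)` the computed marginals,
`F_C(A_C) = 2^n Σₓ q_C(x) q_C(I,x_I)/2^{n−m} − 1 = 2^m Σ_{x_I} q_C(I,x_I)² − 1`
(here `|σ|^{|I|}` for a general local alphabet). [cite: BarakChouGao2021, §5 (first display)] -/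
theorem linearXEB_marginalSampler_marginalOn (I : Finset ι) (q : (ι → σ) → ℝ)
    (hσ : 0 < Fintype.card σ) :
    linearXEB q (marginalSampler I (marginalOn I q)) =
      (Fintype.card σ : ℝ) ^ I.card * ∑ xI, marginalOn I q xI ^ 2 - 1 := by
  rw [linearXEB_marginalSampler I q _ hσ]
  unfold linearXEB
  rw [card_restrict_fun]
  simp_rw [sq]

/-- `Σ q(I,x_I)² ≤ 1` for a (sub)probability `q`: squares of numbers in `[0,1]` summing to at most
one — the fact behind "by [§5's first display], `F_C(A_C) ≤ 2^m`".
[cite: BarakChouGao2021, §5.1 (proof of Cor. ‘Lower bounding the probability of success’)] -/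
theorem sum_marginalOn_sq_le_one (I : Finset ι) {q : (ι → σ) → ℝ} (hq0 : ∀ y, 0 ≤ q y)
    (hq1 : ∑ y, q y ≤ 1) : ∑ xI, marginalOn I q xI ^ 2 ≤ 1 := by
  have hm0 : ∀ xI, 0 ≤ marginalOn I q xI := marginalOn_nonneg I hq0
  have hm1 : ∑ xI, marginalOn I q xI ≤ 1 := by rw [sum_marginalOn]; exact hq1
  have hle : ∀ xI, marginalOn I q xI ≤ 1 := fun xI =>
    le_trans (Finset.single_le_sum (fun z _ => hm0 z) (Finset.mem_univ xI)) hm1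
  calc ∑ xI, marginalOn I q xI ^ 2 ≤ ∑ xI, marginalOn I q xI :=
        Finset.sum_le_sum fun xI _ => by
          rw [sq]; exact mul_le_of_le_one_left (hm0 xI) (hle xI)
    _ ≤ 1 := hm1

/-- **The cap used in §5.1** (proof of the corollary ‘Lower bounding the probability of
success’): "since our algorithm picks `n − m` bits uniformly at random, for every circuit `C`, by
[§5's first display], `F_C(A_C) ≤ 2^m`" — indeed `≤ |σ|^{|I|} − 1`.
[cite: BarakChouGao2021, §5.1 (proof of Cor. ‘Lower bounding the probability of success’)] -/
theorem linearXEB_marginalSampler_marginalOn_le (I : Finset ι) {q : (ι → σ) → ℝ}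
    (hq0 : ∀ y, 0 ≤ q y) (hq1 : ∑ y, q y ≤ 1) (hσ : 0 < Fintype.card σ) :
    linearXEB q (marginalSampler I (marginalOn I q)) ≤ (Fintype.card σ : ℝ) ^ I.card - 1 := by
  rw [linearXEB_marginalSampler_marginalOn I q hσ]
  have hs : (0 : ℝ) ≤ (Fintype.card σ : ℝ) ^ I.card := pow_nonneg (Nat.cast_nonneg _) _
  have := sum_marginalOn_sq_le_one I hq0 hq1
  nlinarith

/-- The printed weaker form `F_C(A_C) ≤ 2^m`.
[cite: BarakChouGao2021, §5.1 (proof of Cor. ‘Lower bounding the probability of success’)] -/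
theorem linearXEB_marginalSampler_marginalOn_le_pow (I : Finset ι) {q : (ι → σ) → ℝ}
    (hq0 : ∀ y, 0 ≤ q y) (hq1 : ∑ y, q y ≤ 1) (hσ : 0 < Fintype.card σ) :
    linearXEB q (marginalSampler I (marginalOn I q)) ≤ (Fintype.card σ : ℝ) ^ I.card := by
  linarith [linearXEB_marginalSampler_marginalOn_le I hq0 hq1 hσ]

/-- **Disjoint light cones (Lemma ‘Disjoint light cone’ ⇒ second line of §5's first display)**: if
the marginal on `I` factorises
over the sites, `q_C(I,x_I) = Π_{j ∈ I} q_C({j}, x_j)` (single-site marginals `r_j`), then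
`F_C(A_C) = Σ_{x_I} Π_j |σ| r_j(x_j)² − 1 = Π_{j ∈ I} (|σ| Σ_b r_j(b)²) − 1`.
[cite: BarakChouGao2021, §5 (first display) and App. §7 Lemma ‘Disjoint light cone’] -/
theorem linearXEB_marginalSampler_of_prod (I : Finset ι) (q : (ι → σ) → ℝ) (r : I → σ → ℝ)
    (hr : ∀ xI : I → σ, marginalOn I q xI = ∏ j, r j (xI j)) (hσ : 0 < Fintype.card σ) :
    linearXEB q (marginalSampler I (marginalOn I q)) =
      ∏ j : I, ((Fintype.card σ : ℝ) * ∑ b, r j b ^ 2) - 1 := by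
  rw [linearXEB_marginalSampler_marginalOn I q hσ]
  congr 1
  simp_rw [hr, ← Finset.prod_pow]
  rw [← Fintype.piFinset_univ, ← Finset.prod_univ_sum (fun _ => Finset.univ) (fun j b => r j b ^ 2),
    Finset.prod_mul_distrib, Finset.prod_const, Finset.card_univ, Fintype.card_coe]

/-- The Bernoulli step from Theorem 1's `E[F_C(A_C)] ≥ (1 + 15^{−d})^m − 1` to the abstract's
"`Ω(n/L · 15^{−d})`": `m δ ≤ (1 + δ)^m − 1` for `δ ≥ 0` (indeed for `δ ≥ −2`).
[cite: BarakChouGao2021, Thm 1 and abstract] -/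
theorem mul_le_one_add_pow_sub_one {δ : ℝ} (hδ : -2 ≤ δ) (m : ℕ) :
    (m : ℝ) * δ ≤ (1 + δ) ^ m - 1 := by
  have := one_add_mul_le_pow hδ m
  linarith

end Marginal

/-! ### §4 Google's patch-circuit estimate versus the whole-system benchmark -/

section Patch

variable {α β : Type*} [Fintype α] [Fintype β]

/-- Marginal of a joint mass function on `α × β` on the first patch (the patch-1 substrings of the
joint samples, "analyzed separately"). [folklore] -/
def fstMarginal (P : α × β → ℝ) : α → ℝ := fun a => ∑ b, P (a, b)

/-- Marginal on the second patch. [folklore] -/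
def sndMarginal (P : α × β → ℝ) : β → ℝ := fun b => ∑ a, P (a, b)

omit [Fintype α] in
/-- For independent patches the first marginal of `p₁ ⊗ p₂` is `p₁`.
[cite: AruteEtAl2019, Supplementary Information §VIII B] -/
theorem fstMarginal_prodPMF (p₁ : α → ℝ) {p₂ : β → ℝ} (h : ∑ b, p₂ b = 1) :
    fstMarginal (prodPMF p₁ p₂) = p₁ := by
  funext a
  simp [fstMarginal, prodPMF, ← Finset.mul_sum, h]

omit [Fintype β] in
/-- For independent patches the second marginal of `p₁ ⊗ p₂` is `p₂`.
[cite: AruteEtAl2019, Supplementary Information §VIII B] -/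
theorem sndMarginal_prodPMF {p₁ : α → ℝ} (h : ∑ a, p₁ a = 1) (p₂ : β → ℝ) :
    sndMarginal (prodPMF p₁ p₂) = p₂ := by
  funext b
  simp [sndMarginal, prodPMF, ← Finset.sum_mul, h]

/-- The global depolarizing model `F · p + (1 − F) · uniform` ("a convex combination of the true
distribution with the uniform distribution") preserves total mass one.
[cite: BoulandFeffermanLandauLiu2022, §1 (footnote on global depolarizing noise)] -/
theorem sum_depolarize {γ : Type*} [Fintype γ] [Nonempty γ] (F : ℝ) {p : γ → ℝ}
    (hp : ∑ x, p x = 1) : ∑ x, depolarize F p x = 1 := by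
  unfold depolarize
  have hN : (Fintype.card γ : ℝ) ≠ 0 := by exact_mod_cast Fintype.card_ne_zero
  rw [Finset.sum_add_distrib, ← Finset.mul_sum, hp, Finset.sum_const, Finset.card_univ,
    nsmul_eq_mul]
  field_simp
  ring

/-- **Google's patch-circuit estimate** of the full-system fidelity from joint samples `P` on two
non-interacting patches with ideal distributions `q₁`, `q₂`: the PRODUCT of the two per-patch linear
XEB values, each computed from that patch's substrings alone — "the two patches are analyzed
separately when computing the fidelity … F_XEB of the full system can be estimated as the product
of the fidelities of the two subsystems". [cite: AruteEtAl2019, Supplementary Information §VIII B]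
-/
def patchXEB (q₁ : α → ℝ) (q₂ : β → ℝ) (P : α × β → ℝ) : ℝ :=
  linearXEB q₁ (fstMarginal P) * linearXEB q₂ (sndMarginal P)

/-- Under independent global depolarizing noise on the two patches (fidelities `F₁`, `F₂`) the patch
estimate reads `(F₁ · F_{q₁}(p₁)) · (F₂ · F_{q₂}(p₂))` — i.e. `F₁ F₂` times the two noiseless patch
values (each `≈ 1` in the primaries' Porter–Thomas reading, not assumed here): "multiplying
together the fidelities of non-interacting subsystems".
[cite: AruteEtAl2019, Supplementary Information §VIII B] -/
theorem patchXEB_prodPMF_depolarize [Nonempty α] [Nonempty β] (q₁ p₁ : α → ℝ) (q₂ p₂ : β → ℝ)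
    (hq₁ : ∑ a, q₁ a = 1) (hq₂ : ∑ b, q₂ b = 1) (hp₁ : ∑ a, p₁ a = 1) (hp₂ : ∑ b, p₂ b = 1)
    (F₁ F₂ : ℝ) :
    patchXEB q₁ q₂ (prodPMF (depolarize F₁ p₁) (depolarize F₂ p₂)) =
      (F₁ * linearXEB q₁ p₁) * (F₂ * linearXEB q₂ p₂) := by
  unfold patchXEB
  rw [fstMarginal_prodPMF _ (sum_depolarize F₂ hp₂), sndMarginal_prodPMF (sum_depolarize F₁ hp₁),
    linearXEB_depolarize q₁ p₁ hq₁, linearXEB_depolarize q₂ p₂ hq₂]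

/-- … whereas the whole-system linear XEB of the same samples against the product ideal `q₁ ⊗ q₂`
is `(F₁ F_{q₁}(p₁) + 1)(F₂ F_{q₂}(p₂) + 1) − 1` — with Porter–Thomas patch values `1` this is
`(1 + F₁)(1 + F₂) − 1 ≈ F₁ + F₂`, not `F₁F₂`: "the XEB generally increases with the number of
subsystems, while the fidelity decays exponentially".
[cite: GaoEtAl2024, §I A eqs. (2)–(3)] -/
theorem linearXEB_prodPMF_depolarize_add_one [Nonempty α] [Nonempty β] (q₁ p₁ : α → ℝ)
    (q₂ p₂ : β → ℝ) (hq₁ : ∑ a, q₁ a = 1) (hq₂ : ∑ b, q₂ b = 1) (F₁ F₂ : ℝ) :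
    linearXEB (prodPMF q₁ q₂) (prodPMF (depolarize F₁ p₁) (depolarize F₂ p₂)) + 1 =
      (F₁ * linearXEB q₁ p₁ + 1) * (F₂ * linearXEB q₂ p₂ + 1) := by
  rw [linearXEB_prodPMF_add_one, linearXEB_depolarize q₁ p₁ hq₁, linearXEB_depolarize q₂ p₂ hq₂]

end Patch

section PiDepolarize

variable {ι : Type*} [Fintype ι] [DecidableEq ι] {α : ι → Type*} [∀ i, Fintype (α i)]
  [∀ i, Nonempty (α i)]

/-- The `k`-subsystem form: independent global depolarizing noise of fidelity `Fᵢ` on each factor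
gives `F_{⊗qᵢ}(⊗ depolarize Fᵢ pᵢ) + 1 = Πᵢ (Fᵢ · F_{qᵢ}(pᵢ) + 1)` against the state fidelity
`Πᵢ Fᵢ` of §2. [cite: GaoEtAl2024, §I A eqs. (2)–(3)] -/
theorem linearXEB_piPMF_depolarize_add_one (q p : ∀ i, α i → ℝ) (hq : ∀ i, ∑ a, q i a = 1)
    (F : ι → ℝ) :
    linearXEB (piPMF q) (piPMF fun i => depolarize (F i) (p i)) + 1 =
      ∏ i, (F i * linearXEB (q i) (p i) + 1) := by
  rw [linearXEB_piPMF_add_one]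
  exact Finset.prod_congr rfl fun i _ => by rw [linearXEB_depolarize (q i) (p i) (hq i)]

end PiDepolarize

end Literature.Computability.QuantumComplexity.XEB

end
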